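import Literature.Computability.AlgebraicComplexity.KV20KernelCircuitOutputs
import Literature.Computability.AlgebraicComplexity.KV20Cor13OfTwosComplementReadout
import Literature.Computability.Complexity.SuccinctKernelVectorReadout
import HarnessLib

/-!
# The coefficient bits of the canonical Kumar–Volk equations are in `PSPACE` (KV20 M1 programme)

The sharper statement behind Cor. 1.3 of [KV22] and the M1 target of record (`hbits` of x5 g6's
`kumarVolk2020_cor_1_3_of_canonicalBits`, `KV20Cor13OfPSPACEEquations.lean`):
`coeffBitLanguage kvCanonicalFamily ∈ PSPACE` — the sign/magnitude bit language of the coefficient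
vectors of the canonical equations `Q_n` is decidable in polynomial space. It is the instance
`Φ := kvMatrixFamily` (t21 g12) of the generic oracle of `SuccinctKernelVectorReadout.lean` (the
succinct kernel-vector circuit `KVC.kvc Φ` of x5 g7 behind p1 g9's split-gate extension
`SuccCircuit.splitExt` and certified evaluator), read through t21 g12's
`coeffBitLanguage_kvCanonicalFamily_mem_PSPACE_of_twosComplementReadout`. (The closer
`kumarVolk2020_cor_1_3_holds` itself is the last declaration of p1 g9's
`KV20Cor13OfSplitCircuit.lean`, RULING (131).)

A CONSEQUENCE fact of [KV22], not Valiant's hypothesis: VP ≠ VNP is not proved here and nothing in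
this file bears on it. Theorems only; census +0.

## References
* [KV22] M. Kumar, B. L. Volk, *A polynomial degree bound on equations for non-rigid matrices and
  small linear circuits*, ACM ToCT 14(2) (2022), Cor. 1.3 and §6. [cite: KumarVolk2022, Cor. 1.3]
-/

noncomputable section

namespace Literature.Computability.AlgebraicComplexity

open Literature.Computability.Complexity Literature.Computability.Complexity.KVC KumarVolk2020
open Literature.LinearAlgebra

/-- On the query range the generic kernel-vector entry of the family IS `kvKernelEntry`.
[cite: KumarVolk2022, §6 (proof of Cor. 1.3)] -/
theorem KumarVolk2020.kvEntry_kvMatrixFamily {n c : ℕ} (hn : 1 ≤ n) (hc : c < (n ^ 3 + 1) ^ (n * n)) :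
    KVC.kvEntry kvMatrixFamily n c = UEval.kvKernelEntry n c := by
  unfold KVC.kvEntry
  rw [dif_pos ⟨two_le_kvCols hn, hc⟩, ← kvc_val_sub_kernelEntry n c hn hc]
  exact (outName_val_sub kvMatrixFamily (two_le_kvCols hn) ⟨c, hc⟩).symm

/-- ★★ **The coefficient bit language of the canonical Kumar–Volk equations is in `PSPACE`** (the
target of record `hbits`). [cite: KumarVolk2022, Cor. 1.3 (proof, §6: "the coefficient vector of
`Q_n` can be computed in space poly(n)")] -/
theorem KumarVolk2020.coeffBitLanguage_kvCanonicalFamily_mem_PSPACE :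
    coeffBitLanguage kvCanonicalFamily ∈ PSPACE :=
  UEval.coeffBitLanguage_kvCanonicalFamily_mem_PSPACE_of_twosComplementReadout (kvc kvMatrixFamily).splitExt
    (X := posName kvMatrixFamily) (X' := negName kvMatrixFamily) (v := kvMatrixFamily.Wmux)
    (posName_fp kvMatrixFamily) (negName_fp kvMatrixFamily) (Wmux_fp kvMatrixFamily)
    (fun n c hn hc => by rw [← kvEntry_kvMatrixFamily hn hc]; exact natAbs_kvEntry_lt kvMatrixFamily n c)
    (fun n c hn hc => by rw [← kvEntry_kvMatrixFamily hn hc]; exact posName_rep kvMatrixFamily n c)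
    (fun n c hn hc => by rw [← kvEntry_kvMatrixFamily hn hc]; exact negName_rep kvMatrixFamily n c)

end Literature.Computability.AlgebraicComplexity

end
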